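import Mathlib
import HarnessLib
import Summits.NavierStokesRegularity.FluidComputer.TriggeredTransferCascadeEnergyClass
import Literature.Analysis.FluidPDE.TaoForcedFiniteEnergyLerayHopfL2

/-!
# The blow-up of a cascade is TYPE II AT ITS BLOW-UP POINT, and the witness is a forced LERAY–HOPF
# weak solution with the ENERGY EQUALITY on every closed sub-slab (door N1-FC, analysis half:
# the local portrait of the witness)

Cell `ns-blowup`, seat `ns-blowup-fc-prover-1` (g7; D-0074 GROUP C «bridge support», door N1-FC).
Companion of `TriggeredTransferCascadeTypeII.lean` / `TriggeredTransferCascadeEnergyClass.lean`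
(g6): the glued witness `ρ.limitVel hν` of a cascade `ρ : 𝒮.Cascade ν` (`ν > 0`) — an exact
classical solution on `[0, T*)` of the system forced by the summed trigger `ρ.force`, singular at
`(T*, limitCentre)`, with bounded energy and finite dissipation up to `T*`. LABEL: E–C bookkeeping
(real analysis over the TYPE `Cascade` + the tree's FACT-FREE forced Leray–Hopf packaging
`IsClassicalNSSolutionOn.isLerayHopfOn_of_finiteEnergy_forced_L2`, Tao 2013 Lemma 8.1 / Lemma 4.1 (i)
WITH force). WHAT THIS IS NOT: not Navier–Stokes evidence and not a construction — `Cascade ν` is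
inhabited only under the OPEN door predicates (`TriggerScheme.Transfers`,
`TriggerSchemeH1.Transfers{,Seeded}`), asserted nowhere; no scheme, cascade, transfer or blow-up is
claimed; nothing here is an item of any route.

* **The Type-I rate fails AT the blow-up point** (answering the reading remark of the cell's
  ledger-refuter lane on p451817: `¬ IsTypeIBlowup` of `SuitableWeak.lean` is a GLOBAL-in-`x`
  failure of `‖u(t, x)‖ ≤ C/√(T* - t)`; for the cascade the failure is LOCAL): under the hypotheses
  of `Cascade.not_isTypeIBlowup_of_frequently` / `…_of_turnover_floor`, for EVERY radius `r > 0`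
  and every constant `C` the rate fails at times `t ↑ T*` at points of `B(limitCentre, r)`
  (`not_typeI_rate_near_limitCentre_of_frequently`, `…_of_turnover_floor`,
  `frequently_typeI_rate_lt_near_limitCentre`) — the floor points `x_n` of `typeI_quantity_ge`
  lie within `ballRadius · λ⁻ⁿ → 0` of the limit centre. Conversely a LOCAL Type-I rate in one
  ball around the limit centre already forces instantaneous transfers `T_n ≤ K²/U_n²`
  (`eventually_T_le_of_local_typeI_rate`), sharpening `eventually_T_le_of_isTypeIBlowup`.
  `isTypeIIBlowup_at_limitCentre_of_turnover_floor` packages: Type II ∧ `(T*, limitCentre)`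
  singular ∧ local failure of every Type-I rate there.
* **Leray–Hopf on every closed sub-slab**: for `0 < T' < T*` the witness is a Leray–Hopf weak
  solution of the forced system on `[0, T')` from the Clay ignition state `w 0`, in the strict sense
  of `Literature/Analysis/FluidPDE/LerayHopf.lean` (weak gradient in `L²_{t,x}`, energy
  inequalities from `0` and from a.e. `s`, weak `L²` continuity, strong attainment of the datum),
  and `u ∈ C([0, T']; L²)` (`Cascade.isLerayHopfOn`); the forced ENERGY EQUALITY
  `½‖u(t)‖₂² + ν∫ₛᵗ∫|∇u|² = ½‖u(s)‖₂² + ∫ₛᵗ∫⟪force, u⟫` holds for all `0 ≤ s ≤ t < T*`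
  (`Cascade.energyEq`). Inputs: `energy_bounded` (p454918) and a UNIFORM `L²` bound of the force
  slices on `[0, T*)` (`lintegral_force_sq_le_uniform`: each window's bound `(A₀ λ^{3n} ε_n)²·|B|`
  is dominated by `(Σ_n A₀ λ^{3n} ε_n)²·|B|`, the sizes being summable). So every tree criterion
  stated for forced `IsLerayHopfOn` solutions applies to the witness on sub-slabs by name.
* Door level: `TriggerScheme.exists_witness_isLerayHopfOn_of_transfers` (v1),
  `TriggerSchemeH1.…_of_transfers` / `…_of_transfersSeeded` (v2).

References: [cite: Seregin2012, §1] (arXiv:1104.3615); [cite: CaffarelliKohnNirenberg1982, §6];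
[cite: Leray1934, §31]; [cite: Tao2011, Lemma 8.1] (Anal. PDE 6 (2013), arXiv Lemma 44) and
Lemma 4.1 (i). 0 sorry; no def; no named fact; axioms ⊆ {propext, Classical.choice, Quot.sound}.
-/

noncomputable section

namespace Summit.NavierStokesRegularity.FluidComputer.TriggeredTransfer

open Set Filter Function MeasureTheory Metric
open scoped Topology ENNReal RealInnerProductSpace
open Literature.Analysis.FluidPDE
open Literature.Analysis.FluidPDE.FluidComputer (E3 Vel)
open Summit.NavierStokesRegularity.FluidComputer.PalasekTowerClayBridge (BreakdownWitness)

namespace TriggerScheme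

/-- The radii `ballRadius · (mag n)⁻¹` of the floor-point neighbourhoods shrink below any `r > 0`. [folklore] -/
theorem eventually_ballRadius_mul_mag_inv_lt (𝒮 : TriggerScheme) {r : ℝ} (hr : 0 < r) :
    ∀ᶠ n in atTop, 𝒮.ballRadius * (𝒮.mag n)⁻¹ < r := by
  have ht : Tendsto (fun n => 𝒮.ballRadius * (𝒮.mag n)⁻¹) atTop (𝓝 0) := by
    simpa using 𝒮.tendsto_mag_inv.const_mul 𝒮.ballRadius
  exact ht.eventually (eventually_lt_nhds hr)

namespace Cascade

variable {𝒮 : TriggerScheme} {ν : ℝ}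

/-! ## The Type-I rate fails AT the blow-up point -/

/-- A turnover floor `θ/U_n ≤ T_n` (large `n`) makes the clock quantity `U_n √T_n` unbounded along
the levels: for every `C`, frequently `C < U_n √T_n`. [folklore] -/
theorem frequently_lt_clock_of_turnover_floor (ρ : 𝒮.Cascade ν) {θ : ℝ} (hθ : 0 < θ)
    (hfloor : ∀ᶠ n in atTop, θ / ρ.U n ≤ (ρ.link n).T) (C : ℝ) :
    ∃ᶠ n in atTop, C < ρ.U n * Real.sqrt (ρ.link n).T := by
  have hdiv : Tendsto (fun n => Real.sqrt (θ * ρ.U n)) atTop atTop :=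
    Real.tendsto_sqrt_atTop.comp (ρ.tendsto_U.const_mul_atTop hθ)
  exact ((hdiv.eventually_gt_atTop C).and hfloor).frequently.mono
    fun n hn => hn.1.trans_le (ρ.sqrt_mul_le_of_turnover_floor hn.2)

/-- **The Type-I rate fails INSIDE EVERY BALL AROUND THE LIMIT CENTRE.** If the clock quantity
`U_n √T_n` is unbounded along the levels (for every `C`, frequently `C < U_n √T_n`), then for every
radius `r > 0` and every constant `C` it is NOT the case that `‖u(t, x)‖ ≤ C/√(T* - t)` for all
`t < T*` near `T*` and all `x ∈ B(limitCentre, r)`: the floor point `x_n` of `typeI_quantity_ge`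
lies within `ballRadius · λ⁻ⁿ < r` of the limit centre for large `n`, and there
`√(T* - start n) · ‖u(start n, x_n)‖ ≥ c · U_n √T_n > C`. LOCAL form of
`not_isTypeIBlowup_of_frequently`. [cite: Seregin2012, §1] -/
theorem not_typeI_rate_near_limitCentre_of_frequently (ρ : 𝒮.Cascade ν) (hν : 0 < ν)
    (h : ∀ C : ℝ, ∃ᶠ n in atTop, C < ρ.U n * Real.sqrt (ρ.link n).T) {r : ℝ} (hr : 0 < r)
    (C : ℝ) :
    ¬ (∀ᶠ t in 𝓝[<] ρ.Tstar, ∀ x ∈ ball ρ.limitCentre r,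
        ‖ρ.limitVel hν t x‖ ≤ C / Real.sqrt (ρ.Tstar - t)) := by
  intro hC
  have hev : ∀ᶠ n in atTop, ∀ x ∈ ball ρ.limitCentre r,
      ‖ρ.limitVel hν (ρ.start n) x‖ ≤ C / Real.sqrt (ρ.Tstar - ρ.start n) :=
    (ρ.tendsto_start_nhdsWithin hν).eventually hC
  obtain ⟨n, ⟨hn, hrad⟩, hlt⟩ :=
    ((hev.and (𝒮.eventually_ballRadius_mul_mag_inv_lt hr)).and_frequently (h (C / 𝒮.c))).exists
  obtain ⟨x, hdist, hx⟩ := ρ.typeI_quantity_ge hν n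
  have hxball : x ∈ ball ρ.limitCentre r := mem_ball.2 (hdist.trans_lt hrad)
  have hpos : 0 < Real.sqrt (ρ.Tstar - ρ.start n) :=
    Real.sqrt_pos.2 (sub_pos.2 (ρ.start_lt_Tstar hν n))
  have h1 : Real.sqrt (ρ.Tstar - ρ.start n) * ‖ρ.limitVel hν (ρ.start n) x‖ ≤ C := by
    rw [mul_comm]; exact (le_div_iff₀ hpos).1 (hn x hxball)
  have h2 : C < 𝒮.c * (ρ.U n * Real.sqrt (ρ.link n).T) := by
    rw [mul_comm]; exact (div_lt_iff₀ 𝒮.c_pos).1 hlt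
  linarith [mul_assoc 𝒮.c (ρ.U n) (Real.sqrt (ρ.link n).T)]

/-- The same, positively: for every `r > 0` and `C`, at times `t ↑ T*` (frequently in `𝓝[<] T*`)
some point of `B(limitCentre, r)` carries speed `> C/√(T* - t)`. [cite: Seregin2012, §1] -/
theorem frequently_typeI_rate_lt_near_limitCentre (ρ : 𝒮.Cascade ν) (hν : 0 < ν)
    (h : ∀ C : ℝ, ∃ᶠ n in atTop, C < ρ.U n * Real.sqrt (ρ.link n).T) {r : ℝ} (hr : 0 < r)
    (C : ℝ) :
    ∃ᶠ t in 𝓝[<] ρ.Tstar, ∃ x ∈ ball ρ.limitCentre r,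
      C / Real.sqrt (ρ.Tstar - t) < ‖ρ.limitVel hν t x‖ := by
  have hne := ρ.not_typeI_rate_near_limitCentre_of_frequently hν h hr C
  rw [not_eventually] at hne
  refine hne.mono fun t ht => ?_
  push Not at ht
  exact ht

/-- **A TURNOVER FLOOR makes the Type-I rate fail inside every ball around the limit centre**:
if `θ/U_n ≤ T_n` for large `n` (`θ > 0`), then for every `r > 0` and `C` the bound
`‖u(t, x)‖ ≤ C/√(T* - t)` on `B(limitCentre, r)` fails at times `t ↑ T*`. LOCAL form of
`not_isTypeIBlowup_of_turnover_floor`. [cite: Seregin2012, §1] -/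
theorem not_typeI_rate_near_limitCentre_of_turnover_floor (ρ : 𝒮.Cascade ν) (hν : 0 < ν)
    {θ : ℝ} (hθ : 0 < θ) (hfloor : ∀ᶠ n in atTop, θ / ρ.U n ≤ (ρ.link n).T) {r : ℝ} (hr : 0 < r)
    (C : ℝ) :
    ¬ (∀ᶠ t in 𝓝[<] ρ.Tstar, ∀ x ∈ ball ρ.limitCentre r,
        ‖ρ.limitVel hν t x‖ ≤ C / Real.sqrt (ρ.Tstar - t)) :=
  ρ.not_typeI_rate_near_limitCentre_of_frequently hν (ρ.frequently_lt_clock_of_turnover_floor hθ hfloor) hr C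

/-- **Where a LOCAL Type-I rate could hide**: if on SOME ball around the limit centre and for SOME
constant the rate `‖u(t, x)‖ ≤ C/√(T* - t)` holds for `t < T*` near `T*`, then the transfers become
instantaneous in their own clock, `T_n ≤ K²/U_n²` for large `n` — the LOCAL sharpening of
`eventually_T_le_of_isTypeIBlowup` (which assumed the rate for all `x`). [cite: Seregin2012, §1] -/
theorem eventually_T_le_of_local_typeI_rate (ρ : 𝒮.Cascade ν) (hν : 0 < ν) {r : ℝ} (hr : 0 < r)
    {C : ℝ} (hC : ∀ᶠ t in 𝓝[<] ρ.Tstar, ∀ x ∈ ball ρ.limitCentre r,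
      ‖ρ.limitVel hν t x‖ ≤ C / Real.sqrt (ρ.Tstar - t)) :
    ∃ K : ℝ, ∀ᶠ n in atTop, (ρ.link n).T ≤ K ^ 2 / ρ.U n ^ 2 := by
  -- first: the clock quantity is eventually bounded
  have hK : ∃ K : ℝ, ∀ᶠ n in atTop, ρ.U n * Real.sqrt (ρ.link n).T ≤ K := by
    by_contra hK
    refine ρ.not_typeI_rate_near_limitCentre_of_frequently hν (fun C' => ?_) hr C hC
    exact (not_eventually.1 fun hc => hK ⟨C', hc⟩).mono fun n hn => not_le.1 hn
  obtain ⟨K, hK⟩ := hK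
  refine ⟨K, hK.mono fun n hn => ?_⟩
  have hU := ρ.U_pos n
  rw [le_div_iff₀ (pow_pos hU 2)]
  calc (ρ.link n).T * ρ.U n ^ 2 = (ρ.U n * Real.sqrt (ρ.link n).T) ^ 2 := by
        rw [mul_pow, Real.sq_sqrt (ρ.link n).T_pos.le]; ring
    _ ≤ K ^ 2 := pow_le_pow_left₀ (mul_nonneg hU.le (Real.sqrt_nonneg _)) hn 2

/-- **EITHER instantaneous transfers OR the Type-I rate fails in EVERY ball around the limit centre
for EVERY constant** (local form of `eventually_T_le_or_isTypeIIBlowup`). [cite: Seregin2012, §1] -/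
theorem eventually_T_le_or_local_rate_fails (ρ : 𝒮.Cascade ν) (hν : 0 < ν) :
    (∃ K : ℝ, ∀ᶠ n in atTop, (ρ.link n).T ≤ K ^ 2 / ρ.U n ^ 2) ∨
      ∀ r : ℝ, 0 < r → ∀ C : ℝ, ∃ᶠ t in 𝓝[<] ρ.Tstar, ∃ x ∈ ball ρ.limitCentre r,
        C / Real.sqrt (ρ.Tstar - t) < ‖ρ.limitVel hν t x‖ := by
  by_cases h : ∃ r : ℝ, 0 < r ∧ ∃ C : ℝ, ∀ᶠ t in 𝓝[<] ρ.Tstar, ∀ x ∈ ball ρ.limitCentre r,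
      ‖ρ.limitVel hν t x‖ ≤ C / Real.sqrt (ρ.Tstar - t)
  · obtain ⟨r, hr, C, hC⟩ := h
    exact Or.inl (ρ.eventually_T_le_of_local_typeI_rate hν hr hC)
  · refine Or.inr fun r hr C => ?_
    have hne : ¬ (∀ᶠ t in 𝓝[<] ρ.Tstar, ∀ x ∈ ball ρ.limitCentre r,
        ‖ρ.limitVel hν t x‖ ≤ C / Real.sqrt (ρ.Tstar - t)) := fun hC => h ⟨r, hr, C, hC⟩
    rw [not_eventually] at hne
    refine hne.mono fun t ht => ?_
    push Not at ht
    exact ht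

/-- **TYPE II AT THE BLOW-UP POINT.** Under a turnover floor `θ/U_n ≤ T_n` (large `n`, `θ > 0`):
the blow-up at `T*` is Type II (Seregin 2012, §1), `(T*, limitCentre)` is a CKN-singular point, and
in every ball `B(limitCentre, r)` the self-similar rate `C/√(T* - t)` is exceeded at times `t ↑ T*`
for every `C` — the Type-II label is carried by the blow-up point itself, not by far-away `x`.
[cite: Seregin2012, §1] -/
theorem isTypeIIBlowup_at_limitCentre_of_turnover_floor (ρ : 𝒮.Cascade ν) (hν : 0 < ν) {θ : ℝ}
    (hθ : 0 < θ) (hfloor : ∀ᶠ n in atTop, θ / ρ.U n ≤ (ρ.link n).T) :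
    IsTypeIIBlowup (ρ.limitVel hν) ρ.Tstar ∧
      ¬ IsRegularPoint (ρ.limitVel hν) (ρ.Tstar, ρ.limitCentre) ∧
      ∀ r : ℝ, 0 < r → ∀ C : ℝ, ∃ᶠ t in 𝓝[<] ρ.Tstar, ∃ x ∈ ball ρ.limitCentre r,
        C / Real.sqrt (ρ.Tstar - t) < ‖ρ.limitVel hν t x‖ :=
  ⟨ρ.isTypeIIBlowup_of_turnover_floor hν hθ hfloor, ρ.not_isRegularPoint_limitCentre hν,
    fun _ hr C => ρ.frequently_typeI_rate_lt_near_limitCentre hν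
      (ρ.frequently_lt_clock_of_turnover_floor hθ hfloor) hr C⟩

/-! ## The force slices are uniformly square-integrable on `[0, T*)` -/

/-- The uniform slice constant `(Σ_n A₀ λ^{3n} ε_n)² · |B(0, ballRadius)|` is finite. [folklore] -/
theorem forceSliceBound_ne_top (ρ : 𝒮.Cascade ν) :
    ENNReal.ofReal ((∑' n, 𝒮.A 0 * (𝒮.mag n ^ 3 * 𝒮.seedAt ν n (ρ.U n))) ^ 2) *
        volume (ball (0 : E3) 𝒮.ballRadius) ≠ ⊤ :=
  ENNReal.mul_ne_top ENNReal.ofReal_ne_top measure_ball_lt_top.ne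

/-- **Uniform `L²` bound of the force slices before `T*`**: for `0 ≤ t < T*`,
`∫ ‖force(t)‖² ≤ (Σ_n A₀ λ^{3n} ε_n)² · |B(0, ballRadius)|` — `t` lies in the window of some level
`n` (`exists_window`), whose bound `(A₀ λ^{3n} ε_n)² · |B|` (`lintegral_force_sq_le`) is dominated
by the square of the (convergent) sum of all the level sizes. [folklore] -/
theorem lintegral_force_sq_le_uniform (ρ : 𝒮.Cascade ν) (hν : 0 < ν) {t : ℝ} (h0 : 0 ≤ t)
    (ht : t < ρ.Tstar) :
    ∫⁻ x, ‖ρ.force t x‖ₑ ^ 2 ≤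
      ENNReal.ofReal ((∑' n, 𝒮.A 0 * (𝒮.mag n ^ 3 * 𝒮.seedAt ν n (ρ.U n))) ^ 2) *
        volume (ball (0 : E3) 𝒮.ballRadius) := by
  obtain ⟨n, h1, h2⟩ := ρ.exists_window hν h0 ht
  have hs : Summable (fun k : ℕ => 𝒮.A 0 * (𝒮.mag k ^ 3 * 𝒮.seedAt ν k (ρ.U k))) := by
    simpa using ρ.summable_frc_bound hν 0
  have hle : 𝒮.A 0 * (𝒮.mag n ^ 3 * 𝒮.seedAt ν n (ρ.U n)) ≤
      ∑' k, 𝒮.A 0 * (𝒮.mag k ^ 3 * 𝒮.seedAt ν k (ρ.U k)) :=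
    hs.le_tsum n fun k _ => ρ.frc_bound_nonneg k
  refine (ρ.lintegral_force_sq_le h1 h2).trans (mul_le_mul' (ENNReal.ofReal_le_ofReal ?_) le_rfl)
  exact pow_le_pow_left₀ (ρ.frc_bound_nonneg n) hle 2

/-! ## Leray–Hopf on every closed sub-slab, and the energy equality -/

/-- The witness is a classical solution of the forced system on every closed sub-slab `[0, T']`,
`0 < T' < T*`. [folklore] -/
theorem limit_classical_Icc (ρ : 𝒮.Cascade ν) (hν : 0 < ν) {T' : ℝ} (hT'0 : 0 < T')
    (hT' : T' < ρ.Tstar) :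
    IsClassicalNSSolutionOn (Icc 0 T') ν ρ.force (ρ.limitVel hν) (ρ.limitPrs hν) :=
  (ρ.limit_classical hν).mono (Icc_subset_Ico_right hT') (uniqueDiffOn_Icc hT'0)

/-- **THE WITNESS IS A FORCED LERAY–HOPF WEAK SOLUTION ON EVERY `[0, T')`, `0 < T' < T*`**, from the
cascade's Clay ignition state `w 0`, and `u ∈ C([0, T']; L²)` — by the tree's fact-free packaging
`IsClassicalNSSolutionOn.isLerayHopfOn_of_finiteEnergy_forced_L2` (Tao 2013, Lemma 8.1 and
Lemma 4.1 (i) WITH force) from `energy_bounded` and `lintegral_force_sq_le_uniform`.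
[cite: Leray1934, §31] -/
theorem isLerayHopfOn (ρ : 𝒮.Cascade ν) (hν : 0 < ν) {T' : ℝ} (hT'0 : 0 < T') (hT' : T' < ρ.Tstar) :
    IsLerayHopfOn T' ν ρ.force (ρ.w 0) (ρ.limitVel hν) ∧
      ContinuousInLpOn (Icc 0 T') 2 (ρ.limitVel hν) := by
  obtain ⟨B, hB, hle⟩ := ρ.energy_bounded hν
  have h := (ρ.limit_classical_Icc hν hT'0 hT').isLerayHopfOn_of_finiteEnergy_forced_L2 hν hT'0
    ρ.forceSliceBound_ne_top
    (fun t ht => ρ.lintegral_force_sq_le_uniform hν ht.1 (ht.2.trans_lt hT'))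
    ⟨B, hB, fun t ht => hle t ⟨ht.1, ht.2.trans_lt hT'⟩⟩
  rwa [ρ.limitVel_zero hν] at h

/-- **THE FORCED ENERGY EQUALITY ALONG THE WITNESS**: for all `0 ≤ s ≤ t < T*`,
`½‖u(t)‖₂² + ν ∫ₛᵗ ∫ |∇u|² = ½‖u(s)‖₂² + ∫ₛᵗ ∫ ⟪force, u⟫` (exact balance, not only Leray's
inequality; Tao 2013, Lemma 8.1 with Lemma 4.1 (i), in the tree's fact-free form
`energyEq_of_finiteEnergy_forced_L2_of_energy`). [cite: Tao2011, Lemma 8.1] -/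
theorem energyEq (ρ : 𝒮.Cascade ν) (hν : 0 < ν) {s t : ℝ} (hs : 0 ≤ s) (hst : s ≤ t)
    (ht : t < ρ.Tstar) :
    VectorCalculus.kineticEnergy (ρ.limitVel hν t) +
        ν * (∫⁻ τ in Ioo s t,
          ∫⁻ x, ENNReal.ofReal (frobeniusNormSq (fderiv ℝ (ρ.limitVel hν τ) x))).toReal =
      VectorCalculus.kineticEnergy (ρ.limitVel hν s) +
        ∫ τ in Ioo s t, ∫ x, ⟪ρ.force τ x, ρ.limitVel hν τ x⟫ := by
  -- work on the closed slab `[0, T']`, `T' = (t + T*)/2`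
  set T' : ℝ := (t + ρ.Tstar) / 2 with hT'_def
  have hTpos := ρ.Tstar_pos hν
  have hT'0 : 0 < T' := by rw [hT'_def]; linarith
  have hT' : T' < ρ.Tstar := by rw [hT'_def]; linarith
  have htT' : t ≤ T' := by rw [hT'_def]; linarith
  obtain ⟨B, hB, hle⟩ := ρ.energy_bounded hν
  exact ((ρ.limit_classical_Icc hν hT'0 hT').energyEq_of_finiteEnergy_forced_L2_of_energy hν hT'0
    ρ.forceSliceBound_ne_top
    (fun τ hτ => ρ.lintegral_force_sq_le_uniform hν hτ.1 (hτ.2.trans_lt hT'))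
    hB.ne (fun τ hτ => hle τ ⟨hτ.1, hτ.2.trans_lt hT'⟩)).2 hs hst htT'

/-- **Energy class + Leray–Hopf + energy equality, packaged** (the local portrait beside
`Cascade.portrait`): bounded energy on `[0, T*)`, finite total dissipation, Leray–Hopf on every
`[0, T')` (`0 < T' < T*`), exact energy balance on every `[s, t] ⊂ [0, T*)`. [cite: Leray1934, §31] -/
theorem lerayHopf_portrait (ρ : 𝒮.Cascade ν) (hν : 0 < ν) :
    (∃ B : ℝ≥0∞, B < ⊤ ∧ ∀ t ∈ Ico 0 ρ.Tstar, ∫⁻ x, ‖ρ.limitVel hν t x‖ₑ ^ 2 ≤ B) ∧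
      (∫⁻ t in Ioo 0 ρ.Tstar,
          ∫⁻ x, ENNReal.ofReal (frobeniusNormSq (fderiv ℝ (ρ.limitVel hν t) x)) < ⊤) ∧
      (∀ T' : ℝ, 0 < T' → T' < ρ.Tstar → IsLerayHopfOn T' ν ρ.force (ρ.w 0) (ρ.limitVel hν)) ∧
      ∀ {s t : ℝ}, 0 ≤ s → s ≤ t → t < ρ.Tstar →
        VectorCalculus.kineticEnergy (ρ.limitVel hν t) +
            ν * (∫⁻ τ in Ioo s t,
              ∫⁻ x, ENNReal.ofReal (frobeniusNormSq (fderiv ℝ (ρ.limitVel hν τ) x))).toReal =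
          VectorCalculus.kineticEnergy (ρ.limitVel hν s) +
            ∫ τ in Ioo s t, ∫ x, ⟪ρ.force τ x, ρ.limitVel hν τ x⟫ :=
  ⟨ρ.energy_bounded hν, ρ.lintegral_dissipation_lt_top hν,
    fun _ hT'0 hT' => (ρ.isLerayHopfOn hν hT'0 hT').1, fun hs hst ht => ρ.energyEq hν hs hst ht⟩

end Cascade

/-! ## At the door -/

/-- **Door v1, Leray–Hopf form.** A transferring scheme (`TriggerScheme.Transfers ν`, `ν > 0`)
yields an exact forced Clay-class blow-up `W` whose velocity is a forced Leray–Hopf weak solution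
from `W.u 0` on every `[0, T')`, `0 < T' < W.T`. [cite: Leray1934, §31] -/
theorem exists_witness_isLerayHopfOn_of_transfers (𝒮 : TriggerScheme) {ν : ℝ} (hν : 0 < ν)
    (hT : 𝒮.Transfers ν) : ∃ W : BreakdownWitness ν,
      ∀ T' : ℝ, 0 < T' → T' < W.T → IsLerayHopfOn T' ν W.f (W.u 0) W.u := by
  obtain ⟨ρ⟩ := 𝒮.nonempty_cascade_of_transfers hν hT
  refine ⟨ρ.toWitness hν, fun T' hT'0 hT' => ?_⟩
  have h := (ρ.isLerayHopfOn hν hT'0 hT').1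
  rw [← ρ.limitVel_zero hν] at h
  exact h

end TriggerScheme

namespace TriggerSchemeH1

/-- **Door v2, Leray–Hopf form** (`H¹` alphabet above ignition). [cite: Leray1934, §31] -/
theorem exists_witness_isLerayHopfOn_of_transfers (𝒮 : TriggerSchemeH1) {ν : ℝ} (hν : 0 < ν)
    (hT : 𝒮.Transfers ν) : ∃ W : BreakdownWitness ν,
      ∀ T' : ℝ, 0 < T' → T' < W.T → IsLerayHopfOn T' ν W.f (W.u 0) W.u := by
  obtain ⟨ρ⟩ := 𝒮.nonempty_cascade hν hT
  refine ⟨ρ.toWitness hν, fun T' hT'0 hT' => ?_⟩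
  have h := (ρ.isLerayHopfOn hν hT'0 hT').1
  rw [← ρ.limitVel_zero hν] at h
  exact h

/-- **Seeded door v2, Leray–Hopf form** (transfers with the level seeds only). [cite: Leray1934, §31] -/
theorem exists_witness_isLerayHopfOn_of_transfersSeeded (𝒮 : TriggerSchemeH1) {ν : ℝ} (hν : 0 < ν)
    (hT : 𝒮.TransfersSeeded ν) : ∃ W : BreakdownWitness ν,
      ∀ T' : ℝ, 0 < T' → T' < W.T → IsLerayHopfOn T' ν W.f (W.u 0) W.u := by
  obtain ⟨ρ⟩ := 𝒮.nonempty_cascade_of_seeded hT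
  refine ⟨ρ.toWitness hν, fun T' hT'0 hT' => ?_⟩
  have h := (ρ.isLerayHopfOn hν hT'0 hT').1
  rw [← ρ.limitVel_zero hν] at h
  exact h

end TriggerSchemeH1

end Summit.NavierStokesRegularity.FluidComputer.TriggeredTransfer

end
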